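import Literature.Computability.MetaComplexity.SmolenskyProperty
import Mathlib.Algebra.Field.ZMod
import HarnessLib

/-!
# Composition of low-degree polynomials on the cube with coordinatewise low-degree maps

Jukna 2012, §2.1 (multilinear polynomials on the Boolean cube, `xᵢ² = xᵢ`): substituting
polynomials of degree `≤ d₀` for the variables of a polynomial of degree `≤ D` gives a polynomial
of degree `≤ D·d₀`. On the cube `{0,1}ⁿ` with the degree filtration `Smolensky.lowDeg`
(`SmolenskyProperty.lean`) this reads: if every coordinate of a map of cubes
`e : {0,1}ᵏ → {0,1}ᵐ` has an INDICATOR of degree `≤ 1` (e.g. `e` affine over `𝔽₂` when `F = 𝔽₂`;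
constants and variables over any field), then `P ↦ P ∘ e` maps `lowDeg F m D` into `lowDeg F k D`
(`comp_mem_lowDeg_of_coord`; the case of constant/variable coordinates is
`comp_subst_mem_lowDeg` of `SmolenskyCorrelationRestrict.lean`). The general version with
coordinate indicators of degree `≤ d₀` gives degree `≤ D·d₀` (`comp_mem_lowDeg_of_coord_mul`).

## References

* S. Jukna, *Boolean Function Complexity*, Springer 2012, §2.1 [JuknaBFC2012].
-/

noncomputable section

namespace Literature.Computability.MetaComplexity

namespace Smolensky

open Finset

variable {F : Type*} [Field F]

/-- A product over `S` of functions of degree `≤ d₀` has degree `≤ |S|·d₀`.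
[cite: JuknaBFC2012, §2.1] -/
theorem prod_mem_lowDeg_card_mul {k d₀ : ℕ} {ι : Type*} (S : Finset ι) (f : ι → CubeFn F k)
    (hf : ∀ i ∈ S, f i ∈ lowDeg F k d₀) : (∏ i ∈ S, f i) ∈ lowDeg F k (S.card * d₀) := by
  classical
  induction S using Finset.induction_on with
  | empty =>
    rw [prod_empty, card_empty, Nat.zero_mul, ← mono_empty]
    exact mono_mem_lowDeg (by simp)
  | insert a S ha ih =>
    rw [prod_insert ha, card_insert_of_notMem ha, Nat.succ_mul, add_comm]
    exact mul_mem_lowDeg_add (hf a (mem_insert_self a S))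
      (ih fun i hi => hf i (mem_insert_of_mem hi))

/-- **Composition lemma, general degree**: if every coordinate of `e : {0,1}ᵏ → {0,1}ᵐ` has an
indicator of degree `≤ d₀`, then `P ∘ e ∈ lowDeg F k (D·d₀)` for `P ∈ lowDeg F m D` (a monomial
`x_S` goes to the product of `|S| ≤ D` coordinate indicators). [cite: JuknaBFC2012, §2.1] -/
theorem comp_mem_lowDeg_of_coord_mul {k m D d₀ : ℕ} (e : (Fin k → Bool) → (Fin m → Bool))
    (he : ∀ i, (fun u => if e u i = true then (1 : F) else 0) ∈ lowDeg F k d₀) {P : CubeFn F m}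
    (hP : P ∈ lowDeg F m D) : (fun u => P (e u)) ∈ lowDeg F k (D * d₀) := by
  rw [lowDeg_eq_span] at hP
  induction hP using Submodule.span_induction with
  | mem Q hQ =>
    obtain ⟨⟨S, hS⟩, rfl⟩ := hQ
    have heq : (fun u => mono F S (e u)) = ∏ i ∈ S, (fun u => if e u i = true then (1 : F) else 0) := by
      funext u
      rw [Finset.prod_apply]
      rfl
    rw [heq]
    exact lowDeg_mono (Nat.mul_le_mul_right _ hS) (prod_mem_lowDeg_card_mul S _ fun i _ => he i)
  | zero => exact Submodule.zero_mem _
  | add Q R _ _ hQ hR =>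
    have h : (fun x => (Q + R) (e x)) = (fun x => Q (e x)) + fun x => R (e x) := by
      funext x; rfl
    rw [h]
    exact Submodule.add_mem _ hQ hR
  | smul a Q _ hQ =>
    have h : (fun x => (a • Q) (e x)) = a • fun x => Q (e x) := by
      funext x; rfl
    rw [h]
    exact Submodule.smul_mem _ a hQ

/-- **Composition lemma** (degree-`1` coordinates, e.g. affine substitutions over `𝔽₂`):
`P ↦ P ∘ e` maps `lowDeg F m D` into `lowDeg F k D`. [cite: JuknaBFC2012, §2.1] -/
theorem comp_mem_lowDeg_of_coord {k m D : ℕ} (e : (Fin k → Bool) → (Fin m → Bool))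
    (he : ∀ i, (fun u => if e u i = true then (1 : F) else 0) ∈ lowDeg F k 1) {P : CubeFn F m}
    (hP : P ∈ lowDeg F m D) : (fun u => P (e u)) ∈ lowDeg F k D := by
  have h := comp_mem_lowDeg_of_coord_mul e he hP
  rwa [Nat.mul_one] at h

/-- Over `𝔽₂` the indicator of an XOR of two coordinates has degree `≤ 1`
(`[uᵢ ⊕ uⱼ] = uᵢ + uⱼ`), so XOR-substitutions are covered. [cite: JuknaBFC2012, §2.1] -/
theorem indicator_xor_mem_lowDeg_one {k : ℕ} (i j : Fin k) :
    (fun u : Fin k → Bool => if xor (u i) (u j) = true then (1 : ZMod 2) else 0) ∈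
      lowDeg (ZMod 2) k 1 := by
  have h : (fun u : Fin k → Bool => if xor (u i) (u j) = true then (1 : ZMod 2) else 0) =
      mono (ZMod 2) {i} + mono (ZMod 2) {j} := by
    funext u
    simp only [Pi.add_apply, mono_apply, Finset.mem_singleton, forall_eq]
    have key : ∀ a b : Bool, (if xor a b = true then (1 : ZMod 2) else 0) =
        (if a = true then 1 else 0) + (if b = true then 1 else 0) := by decide
    exact key (u i) (u j)
  rw [h]
  exact Submodule.add_mem _ (mono_mem_lowDeg (by simp)) (mono_mem_lowDeg (by simp))

end Smolensky

end Literature.Computability.MetaComplexity
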